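import Summits.QuantumFields.YangMills.Theorems.IsotropyFromPowerCountingTemperedCurvatureMomentsApproximantsTransferBumps

/-!
# Transfer of tempered tied approximants between admissible spacing/box data — stub `stub_approximantsTransfer`

Line `Sketch` (markov-shielding) of crux `IsotropyFromPowerCounting.TemperedCurvatureMoments`
(stmt-QuantumFields-17721), Stub A4 of the registered skeleton (model-blind analysis; the bump,
weight and sampling lemmas are in `…ApproximantsTransferBumps.lean`).

Statement (`stub_approximantsTransfer`, registered signature verbatim).  For `n > 0` and a
Schwinger family `S₁` on `ℝ⁴`: if `S₁ n` admits tempered tied lattice approximants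
(`TemperedApproximants`: densities `D_k` on `(ℤ⁴)ⁿ`, tempered at injective multi-sites of the box,
whose Riemann sums converge to `S₁ n F` on off-diagonal real tensors `F`) along ONE admissible
pair `(a', L')` (`a'_k > 0`, `a'_k → 0`, `a'_k L'_k → ∞`), then along EVERY admissible pair
`(a, L)`.  The conclusion of T in degree `n` is thus a property of the limit `S₁ n|⁰𝒮` alone.

Proof.
1. *Domination* (landed `stub_dominatedTieLimit`): with the tempered pair weight
   `w(y) = C (1 + ‖y‖)^N (1 + Σᵢ Σ_{j≠i} ‖yᵢ - yⱼ‖⁻¹)^N` of the given approximants,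
   `‖S₁ n F‖ ≤ ∫ ‖F‖ w` for `F ∈ ⁰𝒮`; and `S₁ n P` is real on off-diagonal real tensors (a limit
   of real Riemann sums lies in the closed set `{im = 0}`).
2. *Bump sampling* (`temperedApproximants_of_dominated`, from domination + realness alone): along
   `(a, L)` put `D_k x = (a_k⁴)⁻ⁿ Re S₁ n (η_{k,x})`, `η_{k,x}` the complexified product bump
   `∏ᵢ ∏_c ρ(yᵢᶜ/a_k - xᵢᶜ)`, if the scaled multi-site `a_k x` is pairwise `8 a_k`-separated, and
   `D_k x = 0` otherwise.  Then `η_{k,x} ∈ ⁰𝒮` (`isOffDiagonal_of_tsupport_subset_ball`) and, for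
   `2 a_k ≤ 1`, `|D_k x| ≤ 4^N 2^{4n} vol B̄(0,1) · C (1 + ‖a_k x‖)^N (1 + ΣΣ ‖a_k xᵢ - a_k xⱼ‖⁻¹)^N`
   (`abs_density_le`: `‖η‖ ≤ 1` lives on `B̄(a_k x, 2a_k)`, where `w ≤ 4^N w(a_k x)`).
3. *Convergence on separated tensors* (`tendsto_riemann_bumpSampled`): for `P = ⊗ fᵢ` real with
   compactly supported `r`-separated factors, eventually
   `(a_k⁴)ⁿ Σ_x (∏ fᵢ(a_k xᵢ)) D_k x = Re S₁ n G_k` with `G_k = Σ_x P(a_k x) η_{k,x}`; by the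
   partition of unity and the Lipschitz bound, `‖G_k - P‖_∞ ≤ 2 ‖P‖_{0,1} a_k` and `G_k - P ∈ ⁰𝒮`
   lives on a fixed bounded `r/2`-separated region where `w` is bounded, so
   `|S₁ n G_k - S₁ n P| ≤ ∫ ‖G_k - P‖ w = O(a_k) → 0`.
4. *All of `⁰𝒮`*: the landed `stub_truncatedTieLimit` over `stub_sepDensity` (A2 over A1).

References: K. Osterwalder, R. Schrader, Comm. Math. Phys. 31 (1973) §2 and 42 (1975) §2
(`⁰𝒮`, temperedness of lattice approximants); J. Glimm, A. Jaffe, Quantum Physics (1987)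
§9.5–9.6 (lattice approximation). [folklore]
-/

noncomputable section

namespace Summit.QuantumFields.YangMills.Theorems.TemperedCurvatureMoments.Sketch

open scoped BigOperators SchwartzMap
open MeasureTheory Filter Topology Set
open Literature.MathematicalPhysics.QuantumFieldTheory Literature.MathematicalPhysics.QuantumLattice
open Literature.MathematicalPhysics.AQFT
open Literature.Probability.LatticeModels (box Site mem_box box_mono)
open Summit.QuantumFields.YangMills.Theorems.NPointIsotropy.Negative (E4)
open Summit.QuantumFields.YangMills.Theorems.TemperedCurvatureMoments.Negative (TemperedApproximants)
open Summit.QuantumFields.YangMills.Theorems.CurvatureBoostCovariance.BoostsInheritMirrors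
  (stub_dominatedTieLimit)

namespace ApproximantsTransfer

/-- **Scaled multi-sites with all components in `B̄(0, R)` lie in the box** once `R ≤ a L`. [folklore] -/
theorem mem_piFinset_box_of_norm_le {n : ℕ} {a R : ℝ} (ha : 0 < a) {L : ℕ} (hL : R ≤ a * L)
    {x : Fin n → Site 4} (hx : ∀ i, ‖a • siteToE (x i)‖ ≤ R) :
    x ∈ Fintype.piFinset fun _ : Fin n => box 4 L := by
  refine Fintype.mem_piFinset.2 fun i => mem_box.2 fun c => ?_
  have h1 : |a * (x i c : ℝ)| ≤ R := by
    have h := PiLp.norm_apply_le (a • siteToE (x i)) c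
    rw [PiLp.smul_apply, siteToE_apply, smul_eq_mul, Real.norm_eq_abs] at h
    exact h.trans (hx i)
  rw [abs_mul, abs_of_pos ha] at h1
  have h2 : |(x i c : ℝ)| ≤ L := le_of_mul_le_mul_left (h1.trans hL) ha
  have h3 : |x i c| ≤ (L : ℤ) := by exact_mod_cast h2
  exact ⟨(abs_le.1 h3).1, (abs_le.1 h3).2⟩

/-- **A test function supported in `B̄(a x, 2a)` around an `8a`-separated scaled multi-site is
off-diagonal**: its support misses the coincidence locus. [folklore] -/
theorem isOffDiagonal_of_tsupport_subset_ball {n : ℕ} {a : ℝ} (ha : 0 < a) {x : Fin n → Site 4}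
    (hsep : ∀ i j, i ≠ j → 8 * a ≤ ‖a • siteToE (x i) - a • siteToE (x j)‖)
    (G : 𝓢((Fin n → E4), ℂ))
    (hG : tsupport (G : (Fin n → E4) → ℂ) ⊆ Metric.closedBall (fun i => a • siteToE (x i)) (2 * a)) :
    IsOffDiagonal G := by
  refine IsOffDiagonal.of_tsupport_subset fun y hy hyA => ?_
  obtain ⟨i, j, hij, hyij⟩ := hyA
  have hyball := hG hy
  rw [Metric.mem_closedBall, dist_eq_norm] at hyball
  have hyi : ∀ i, ‖y i - a • siteToE (x i)‖ ≤ 2 * a := fun i =>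
    (norm_le_pi_norm (y - fun i => a • siteToE (x i)) i).trans hyball
  have h1 : ‖a • siteToE (x i) - a • siteToE (x j)‖ ≤
      ‖a • siteToE (x i) - y i‖ + ‖y i - a • siteToE (x j)‖ := norm_sub_le_norm_sub_add_norm_sub _ _ _
  have h2 : ‖y i - a • siteToE (x j)‖ ≤ 2 * a := by rw [hyij]; exact hyi j
  rw [norm_sub_rev (a • siteToE (x i)) (y i)] at h1
  linarith [hsep i j hij, hyi i, mul_pos (by norm_num : (0 : ℝ) < 8) ha]

/-- `⁰𝒮` is closed under finite sums. [folklore] -/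
theorem isOffDiagonal_sum {n : ℕ} {ι : Type*} (s : Finset ι) (g : ι → 𝓢((Fin n → E4), ℂ))
    (h : ∀ i ∈ s, IsOffDiagonal (g i)) : IsOffDiagonal (∑ i ∈ s, g i) :=
  Finset.sum_induction g IsOffDiagonal (fun _ _ hF hG => hF.add hG) isOffDiagonal_zero h

/-- `⁰𝒮` is closed under differences. [folklore] -/
theorem isOffDiagonal_sub {n : ℕ} {F G : 𝓢((Fin n → E4), ℂ)} (hF : IsOffDiagonal F)
    (hG : IsOffDiagonal G) : IsOffDiagonal (F - G) := by
  have h := hF.add (hG.smul (-1))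
  rwa [neg_one_smul, ← sub_eq_add_neg] at h

/-- **Temperedness of the bump-sampled density.** If `‖T F‖ ≤ ∫ ‖F‖ w` on `⁰𝒮` and `η ∈ ⁰𝒮` is the
complexified product bump at the `8a`-separated scaled multi-site `a x` (`0 < a`, `2a ≤ 1`), then
`(a⁴)⁻ⁿ |Re T η| ≤ 4^N 2^{4n} vol B̄(0,1) · w(a x)`: `‖η‖ ≤ 1` vanishes off `B̄(a x, 2a)`, where
`w ≤ 4^N w(a x)`, and `vol B̄(a x, 2a) = (2a)^{4n} vol B̄(0, 1)`. [folklore] -/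
theorem abs_density_le {n : ℕ} (T : 𝓢((Fin n → E4), ℂ) →L[ℂ] ℂ) {C : ℝ} (hC : 0 < C) (N : ℕ)
    (hdom : ∀ F : 𝓢((Fin n → E4), ℂ), IsOffDiagonal F →
      ‖T F‖ ≤ ∫ y, ‖F y‖ * (C * (1 + ‖y‖) ^ N * (1 + ∑ i, ∑ j ∈ Finset.univ.erase i, ‖y i - y j‖⁻¹) ^ N))
    {a : ℝ} (ha : 0 < a) (ha1 : 2 * a ≤ 1) (x : Fin n → Site 4)
    (hsep : ∀ i j, i ≠ j → 8 * a ≤ ‖a • siteToE (x i) - a • siteToE (x j)‖)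
    (G : 𝓢((Fin n → E4), ℂ)) (hG : ∀ y, G y = ((∏ i, ∏ c, pouBump (y i c / a - x i c) : ℝ) : ℂ))
    (hGoff : IsOffDiagonal G) :
    |((a ^ 4) ^ n)⁻¹ * (T G).re| ≤
      (4 : ℝ) ^ N * 2 ^ (n * 4) * (volume (Metric.closedBall (0 : Fin n → E4) 1)).toReal * C *
        (1 + ‖fun i => a • siteToE (x i)‖) ^ N *
        (1 + ∑ i, ∑ j ∈ Finset.univ.erase i, ‖a • siteToE (x i) - a • siteToE (x j)‖⁻¹) ^ N := by
  have hint := integral_norm_mul_weight_le_of_ball hC N ha ha1 (v := fun i => a • siteToE (x i)) hsep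
    (⇑G) (fun y => by
      rw [hG, Complex.norm_real, Real.norm_of_nonneg (prodBump_nonneg a x y)]
      exact prodBump_le_one a x y)
    (fun y hy => (norm_sub_le_of_prodBump_ne_zero ha (by rwa [hG, Complex.ofReal_ne_zero] at hy)).2)
  have hapos : 0 < (a ^ 4) ^ n := by positivity
  have hkey : ((a ^ 4) ^ n)⁻¹ * (2 * a) ^ (n * 4) = 2 ^ (n * 4) := by
    field_simp
    ring
  rw [abs_mul, abs_inv, abs_of_pos hapos]
  calc ((a ^ 4) ^ n)⁻¹ * |(T G).re|
      ≤ ((a ^ 4) ^ n)⁻¹ * ((4 : ℝ) ^ N * (C * (1 + ‖fun i => a • siteToE (x i)‖) ^ N *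
          (1 + ∑ i, ∑ j ∈ Finset.univ.erase i, ‖a • siteToE (x i) - a • siteToE (x j)‖⁻¹) ^ N) *
          ((2 * a) ^ (n * 4) * (volume (Metric.closedBall (0 : Fin n → E4) 1)).toReal)) :=
        mul_le_mul_of_nonneg_left (((Complex.abs_re_le_norm _).trans (hdom G hGoff)).trans hint)
          (by positivity)
    _ = ((a ^ 4) ^ n)⁻¹ * (2 * a) ^ (n * 4) * ((4 : ℝ) ^ N *
          (volume (Metric.closedBall (0 : Fin n → E4) 1)).toReal * C *
          (1 + ‖fun i => a • siteToE (x i)‖) ^ N *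
          (1 + ∑ i, ∑ j ∈ Finset.univ.erase i, ‖a • siteToE (x i) - a • siteToE (x j)‖⁻¹) ^ N) := by
        ring
    _ = _ := by rw [hkey]; ring

/-- **Convergence of the bump-sampled Riemann sums on separated tensors.**  Let `‖T F‖ ≤ ∫ ‖F‖ w`
on `⁰𝒮`, `a_k → 0⁺`, `a_k L_k → ∞`, `η_{k,x}` the complexified product bumps (off-diagonal at
`8a_k`-separated scaled multi-sites) and `D_k` densities with `(a_k⁴)ⁿ D_k x = Re T η_{k,x}` at
separated `x`.  For a real product tensor `P = ⊗ fᵢ` with compactly supported, `r`-separated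
factors and `T P` real, the Riemann sums `(a_k⁴)ⁿ Σ_x (∏ fᵢ(a_k xᵢ)) D_k x` equal `Re T G_k`
eventually, `G_k = Σ_x P(a_k x) η_{k,x}` (non-separated `x` carry `P(a_k x) = 0` once `8a_k ≤ r`);
`G_k - P ∈ ⁰𝒮` is `2‖P‖_{0,1} a_k`-small and lives on a fixed bounded `r/2`-separated region, so
`‖T G_k - T P‖ ≤ ∫ ‖G_k - P‖ w = O(a_k) → 0`. [folklore] -/
theorem tendsto_riemann_bumpSampled {n : ℕ} (T : 𝓢((Fin n → E4), ℂ) →L[ℂ] ℂ) {C : ℝ} (hC : 0 < C)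
    (N : ℕ)
    (hdom : ∀ F : 𝓢((Fin n → E4), ℂ), IsOffDiagonal F →
      ‖T F‖ ≤ ∫ y, ‖F y‖ * (C * (1 + ‖y‖) ^ N * (1 + ∑ i, ∑ j ∈ Finset.univ.erase i, ‖y i - y j‖⁻¹) ^ N))
    {a : ℕ → ℝ} (ha : ∀ k, 0 < a k) (ha0 : Tendsto a atTop (𝓝 0)) {L : ℕ → ℕ}
    (haL : Tendsto (fun k => a k * L k) atTop atTop)
    (η : ℕ → (Fin n → Site 4) → 𝓢((Fin n → E4), ℂ))
    (hη : ∀ k x y, η k x y = ((∏ i, ∏ c, pouBump (y i c / a k - x i c) : ℝ) : ℂ))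
    (hηoff : ∀ k x, (∀ i j, i ≠ j → 8 * a k ≤ ‖a k • siteToE (x i) - a k • siteToE (x j)‖) →
      IsOffDiagonal (η k x))
    (D : ℕ → (Fin n → Site 4) → ℝ)
    (hD1 : ∀ k x, (∀ i j, i ≠ j → 8 * a k ≤ ‖a k • siteToE (x i) - a k • siteToE (x j)‖) →
      (a k ^ 4) ^ n * D k x = (T (η k x)).re)
    (f : Fin n → 𝓢(E4, ℝ)) (P : 𝓢((Fin n → E4), ℂ)) (hP : IsTensorOf P (fun i => ofRealTest (f i)))
    (hPreal : (T P).im = 0) {r R : ℝ} (hr : 0 < r)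
    (hR : ∀ i, tsupport (f i : E4 → ℝ) ⊆ Metric.closedBall (0 : E4) R)
    (hsep : ∀ i j, i ≠ j → ∀ y ∈ tsupport (f i : E4 → ℝ), ∀ z ∈ tsupport (f j : E4 → ℝ),
      r ≤ ‖y - z‖) :
    Tendsto (fun k => (((a k ^ 4) ^ n * ∑ x ∈ Fintype.piFinset (fun _ : Fin n => box 4 (L k)),
      (∏ i, f i (a k • siteToE (x i))) * D k x : ℝ) : ℂ)) atTop (𝓝 (T P)) := by
  -- WLOG `R ≥ 0`; the values and the support of `P`
  set R₀ : ℝ := max R 0 with hR₀def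
  have hR₀ : 0 ≤ R₀ := le_max_right _ _
  have hPval : ∀ z, P z = ((∏ i, f i (z i) : ℝ) : ℂ) := fun z => by
    rw [hP z, Complex.ofReal_prod]; rfl
  have hPsupp : ∀ z, P z ≠ 0 → (∀ i, ‖z i‖ ≤ R₀) ∧ ∀ i j, i ≠ j → r ≤ ‖z i - z j‖ := by
    intro z hz
    rw [hPval, Complex.ofReal_ne_zero, Finset.prod_ne_zero_iff] at hz
    have hzi : ∀ i, z i ∈ tsupport (f i : E4 → ℝ) := fun i =>
      subset_tsupport _ (Function.mem_support.2 (hz i (Finset.mem_univ i)))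
    exact ⟨fun i => (mem_closedBall_zero_iff.1 (hR i (hzi i))).trans (le_max_left _ _),
      fun i j hij => hsep i j hij _ (hzi i) _ (hzi j)⟩
  set K : ℝ := SchwartzMap.seminorm ℂ 0 1 P with hK
  have hK0 : 0 ≤ K := apply_nonneg _ _
  obtain ⟨Gk, hGk⟩ : ∃ Gk : ℕ → 𝓢((Fin n → E4), ℂ), ∀ k, Gk k =
      ∑ x ∈ Fintype.piFinset (fun _ : Fin n => box 4 (L k)),
        ((∏ i, f i (a k • siteToE (x i)) : ℝ) : ℂ) • η k x := ⟨_, fun _ => rfl⟩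
  -- eventually: small mesh, large box
  have hev : ∀ᶠ k in atTop, 2 * a k ≤ 1 ∧ 8 * a k ≤ r ∧ R₀ ≤ a k * L k := by
    filter_upwards [ha0.eventually (eventually_le_nhds (by norm_num : (0 : ℝ) < 1 / 2)),
      ha0.eventually (eventually_le_nhds (by positivity : (0 : ℝ) < r / 8)),
      haL.eventually_ge_atTop R₀] with k hk1 hk2 hk3
    exact ⟨by linarith, by linarith, hk3⟩
  -- non-separated multi-sites carry no mass once `8 a_k ≤ r`
  have hT0 : ∀ (k : ℕ) (x : Fin n → Site 4), 8 * a k ≤ r →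
      ¬ (∀ i j, i ≠ j → 8 * a k ≤ ‖a k • siteToE (x i) - a k • siteToE (x j)‖) →
      ∏ i, f i (a k • siteToE (x i)) = 0 := by
    intro k x hk hadm
    by_contra h
    have hPx : P (fun i => a k • siteToE (x i)) ≠ 0 := by
      rw [hPval, Complex.ofReal_ne_zero]; exact h
    exact hadm fun i j hij => hk.trans ((hPsupp _ hPx).2 i j hij)
  -- (i) the Riemann term is `Re T G_k`, eventually
  have hRe : ∀ᶠ k in atTop, (((T (Gk k)).re : ℝ) : ℂ) = (((a k ^ 4) ^ n *
      ∑ x ∈ Fintype.piFinset (fun _ : Fin n => box 4 (L k)),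
        (∏ i, f i (a k • siteToE (x i))) * D k x : ℝ) : ℂ) := by
    filter_upwards [hev] with k hk
    congr 1
    rw [hGk k, map_sum, Complex.re_sum, Finset.mul_sum]
    refine Finset.sum_congr rfl fun x _ => ?_
    rw [map_smul, smul_eq_mul, Complex.re_ofReal_mul]
    by_cases hadm : ∀ i j, i ≠ j → 8 * a k ≤ ‖a k • siteToE (x i) - a k • siteToE (x j)‖
    · rw [← hD1 k x hadm]; ring
    · rw [hT0 k x hk.2.1 hadm]; ring
  -- (ii) `G_k - P ∈ ⁰𝒮`
  have hPoff : IsOffDiagonal P := isOffDiagonal_of_isTensorOf_separated hP hr hsep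
  have hGoff : ∀ k, 8 * a k ≤ r → IsOffDiagonal (Gk k - P) := by
    intro k hk
    rw [hGk k]
    refine isOffDiagonal_sub (isOffDiagonal_sum _ _ fun x _ => ?_) hPoff
    by_cases hadm : ∀ i j, i ≠ j → 8 * a k ≤ ‖a k • siteToE (x i) - a k • siteToE (x j)‖
    · exact (hηoff k x hadm).smul _
    · rw [hT0 k x hk hadm, Complex.ofReal_zero, zero_smul]; exact isOffDiagonal_zero
  -- (iii) `G_k - P` pointwise
  have hGP : ∀ k y, (Gk k - P) y = ∑ x ∈ Fintype.piFinset (fun _ : Fin n => box 4 (L k)),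
      P (fun i => a k • siteToE (x i)) * ((∏ i, ∏ c, pouBump (y i c / a k - x i c) : ℝ) : ℂ) - P y := by
    intro k y
    change Gk k y - P y = _
    rw [hGk k, sum_apply]
    refine congrArg (· - P y) (Finset.sum_congr rfl fun x _ => ?_)
    rw [smul_apply, smul_eq_mul, hPval, hη]
  -- (iv) `‖T G_k - T P‖ ≤ M a_k`, eventually
  have hbound : ∀ᶠ k in atTop, ‖T (Gk k) - T P‖ ≤
      2 * K * (C * (2 + R₀) ^ N * (1 + (n : ℝ) ^ 2 * (2 / r)) ^ N) *
        (volume (Metric.closedBall (0 : Fin n → E4) (R₀ + 1))).toReal * a k := by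
    filter_upwards [hev] with k hk
    obtain ⟨hk1, hk2, hk3⟩ := hk
    have hPB : ∀ x : Fin n → Site 4, P (fun i => a k • siteToE (x i)) ≠ 0 →
        x ∈ Fintype.piFinset (fun _ : Fin n => box 4 (L k)) := fun x hx =>
      mem_piFinset_box_of_norm_le (ha k) hk3 (hPsupp _ hx).1
    have hε : ∀ y, ‖(Gk k - P) y‖ ≤ 2 * K * a k := fun y => by
      rw [hGP]; exact norm_sum_mul_bump_sub_le (ha k) P (L k) hPB y
    have h0 : ∀ y, (Gk k - P) y ≠ 0 →
        (∀ i, ‖y i‖ ≤ R₀ + 1) ∧ ∀ i j, i ≠ j → r / 2 ≤ ‖y i - y j‖ := fun y hy =>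
      bound_of_sum_mul_bump_sub_ne_zero (ha k) hk1 hk2 P hPsupp _ y (by rwa [hGP] at hy)
    have hint := integral_norm_mul_weight_le_of_separated hC N hR₀ hr
      (mul_nonneg (mul_nonneg zero_le_two hK0) (ha k).le) (⇑(Gk k - P)) hε h0
    rw [← map_sub]
    refine ((hdom _ (hGoff k hk2)).trans hint).trans_eq ?_
    ring
  -- (v) convergence
  have h1 : Tendsto (fun k => T (Gk k)) atTop (𝓝 (T P)) := by
    rw [← tendsto_sub_nhds_zero_iff]
    refine squeeze_zero_norm' hbound ?_
    simpa using ha0.const_mul (2 * K * (C * (2 + R₀) ^ N * (1 + (n : ℝ) ^ 2 * (2 / r)) ^ N) *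
      (volume (Metric.closedBall (0 : Fin n → E4) (R₀ + 1))).toReal)
  have h2 : Tendsto (fun k => (((T (Gk k)).re : ℝ) : ℂ)) atTop (𝓝 (((T P).re : ℝ) : ℂ)) :=
    ((Complex.continuous_re.tendsto _).comp h1).ofReal
  have hTP : (((T P).re : ℝ) : ℂ) = T P := Complex.ext (by simp) (by simp [hPreal])
  rw [hTP] at h2
  exact h2.congr' hRe

end ApproximantsTransfer

open ApproximantsTransfer

/-- **Tempered approximants from domination and realness** (Steps 2–4 of `stub_approximantsTransfer`,
the reusable part).  If `‖S₁ n F‖ ≤ ∫ ‖F‖ w` on `⁰𝒮` for the tempered pair weight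
`w = C (1 + ‖y‖)^N (1 + ΣΣ ‖yᵢ - yⱼ‖⁻¹)^N` and `S₁ n` is real on the off-diagonal real tensors, then
`S₁ n` admits tempered tied lattice approximants along EVERY admissible `(a, L)`: the bump-sampled
densities `D_k x = (a_k⁴)⁻ⁿ Re S₁ n (η_{k,x})` at `8a_k`-separated scaled multi-sites (zero otherwise)
are tempered (`abs_density_le`) and their Riemann sums converge on separated compactly supported
real tensors (`tendsto_riemann_bumpSampled`), hence on `⁰𝒮` (`stub_truncatedTieLimit` over
`stub_sepDensity`). [folklore] -/
theorem temperedApproximants_of_dominated {n : ℕ} (hn : 0 < n) (S₁ : SchwingerFamily E4) {C : ℝ}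
    {N : ℕ} (hC : 0 < C)
    (hdom : ∀ F : 𝓢((Fin n → E4), ℂ), IsOffDiagonal F →
      Integrable (fun y => ‖F y‖ * (C * (1 + ‖y‖) ^ N *
        (1 + ∑ i, ∑ j ∈ Finset.univ.erase i, ‖y i - y j‖⁻¹) ^ N)) ∧
      ‖S₁ n F‖ ≤ ∫ y, ‖F y‖ * (C * (1 + ‖y‖) ^ N *
        (1 + ∑ i, ∑ j ∈ Finset.univ.erase i, ‖y i - y j‖⁻¹) ^ N))
    (hreal : ∀ (f : Fin n → 𝓢(E4, ℝ)) (F : 𝓢((Fin n → E4), ℂ)),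
      IsTensorOf F (fun i => ofRealTest (f i)) → IsOffDiagonal F → (S₁ n F).im = 0)
    {a : ℕ → ℝ} {L : ℕ → ℕ} (ha : ∀ k, 0 < a k) (ha0 : Tendsto a atTop (𝓝 0))
    (haL : Tendsto (fun k => a k * L k) atTop atTop) : TemperedApproximants a L S₁ n := by
  have hdom' : ∀ F : 𝓢((Fin n → E4), ℂ), IsOffDiagonal F → ‖S₁ n F‖ ≤
      ∫ y, ‖F y‖ * (C * (1 + ‖y‖) ^ N * (1 + ∑ i, ∑ j ∈ Finset.univ.erase i, ‖y i - y j‖⁻¹) ^ N) :=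
    fun F hF => (hdom F hF).2
  -- the bumps `η_{k,x}` along `(a, L)`
  obtain ⟨η, hη⟩ : ∃ η : ℕ → (Fin n → Site 4) → 𝓢((Fin n → E4), ℂ), ∀ k x, η k x =
      (hasCompactSupport_prodBumpC (ha k) x).toSchwartzMap (contDiff_prodBumpC (a k) x) :=
    ⟨_, fun _ _ => rfl⟩
  have hηapply : ∀ k x y, η k x y = ((∏ i, ∏ c, pouBump (y i c / a k - x i c) : ℝ) : ℂ) :=
    fun k x y => by rw [hη]; rfl
  have hηoff : ∀ k x, (∀ i j, i ≠ j → 8 * a k ≤ ‖a k • siteToE (x i) - a k • siteToE (x j)‖) →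
      IsOffDiagonal (η k x) := fun k x hadm => by
    rw [hη]
    exact isOffDiagonal_of_tsupport_subset_ball (ha k) hadm _ (tsupport_prodBumpC_subset (ha k) x)
  -- the bump-sampled densities
  obtain ⟨D, hD, hD0⟩ : ∃ D : ℕ → (Fin n → Site 4) → ℝ,
      (∀ k x, (∀ i j, i ≠ j → 8 * a k ≤ ‖a k • siteToE (x i) - a k • siteToE (x j)‖) →
        D k x = ((a k ^ 4) ^ n)⁻¹ * (S₁ n (η k x)).re) ∧
      (∀ k x, ¬ (∀ i j, i ≠ j → 8 * a k ≤ ‖a k • siteToE (x i) - a k • siteToE (x j)‖) →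
        D k x = 0) := by
    classical
    exact ⟨fun k x => if ∀ i j, i ≠ j → 8 * a k ≤ ‖a k • siteToE (x i) - a k • siteToE (x j)‖ then
        ((a k ^ 4) ^ n)⁻¹ * (S₁ n (η k x)).re else 0, fun k x h => if_pos h, fun k x h => if_neg h⟩
  have hD1 : ∀ k x, (∀ i j, i ≠ j → 8 * a k ≤ ‖a k • siteToE (x i) - a k • siteToE (x j)‖) →
      (a k ^ 4) ^ n * D k x = (S₁ n (η k x)).re := fun k x hadm => by
    rw [hD k x hadm, mul_inv_cancel_left₀ (pow_pos (pow_pos (ha k) 4) n).ne']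
  obtain ⟨k₁, hk₁⟩ : ∃ k₁ : ℕ, ∀ k, k₁ ≤ k → 2 * a k ≤ 1 := by
    obtain ⟨k₁, hk₁⟩ := eventually_atTop.1
      (ha0.eventually (eventually_le_nhds (by norm_num : (0 : ℝ) < 1 / 2)))
    exact ⟨k₁, fun k hk => by linarith [hk₁ k hk]⟩
  -- temperedness
  have htemp : ∀ k, k₁ ≤ k → ∀ x : Fin n → Site 4, (∀ i, x i ∈ box 4 (L k)) → Function.Injective x →
      |D k x| ≤ ((4 : ℝ) ^ N * 2 ^ (n * 4) * (volume (Metric.closedBall (0 : Fin n → E4) 1)).toReal *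
          C + 1) * (1 + ‖fun i => a k • siteToE (x i)‖) ^ N *
        (1 + ∑ i, ∑ j ∈ Finset.univ.erase i, ‖a k • siteToE (x i) - a k • siteToE (x j)‖⁻¹) ^ N := by
    intro k hk x _ _
    have hS : 0 ≤ (1 + ‖fun i => a k • siteToE (x i)‖) ^ N *
        (1 + ∑ i, ∑ j ∈ Finset.univ.erase i, ‖a k • siteToE (x i) - a k • siteToE (x j)‖⁻¹) ^ N := by
      positivity
    by_cases hadm : ∀ i j, i ≠ j → 8 * a k ≤ ‖a k • siteToE (x i) - a k • siteToE (x j)‖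
    · have h := abs_density_le (S₁ n) hC N hdom' (ha k) (hk₁ k hk) x hadm (η k x) (hηapply k x)
        (hηoff k x hadm)
      rw [hD k x hadm]
      linarith [h, hS]
    · rw [hD0 k x hadm, abs_zero]
      positivity
  refine ⟨D, _, N, k₁, by positivity, htemp, ?_⟩
  -- convergence on separated tensors, then on `⁰𝒮` (A2 over A1)
  have hsepconv : ∀ (f : Fin n → 𝓢(E4, ℝ)) (P : 𝓢((Fin n → E4), ℂ)),
      IsTensorOf P (fun i => ofRealTest (f i)) →
      (∃ r R : ℝ, 0 < r ∧ (∀ i, tsupport (f i : E4 → ℝ) ⊆ Metric.closedBall (0 : E4) R) ∧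
        ∀ i j, i ≠ j → ∀ y ∈ tsupport (f i : E4 → ℝ), ∀ z ∈ tsupport (f j : E4 → ℝ), r ≤ ‖y - z‖) →
      Tendsto (fun k => (((a k ^ 4) ^ n *
        ∑ x ∈ Fintype.piFinset (fun _ : Fin n => box 4 (L k)),
          (∏ i, f i (a k • siteToE (x i))) * D k x : ℝ) : ℂ)) atTop (𝓝 (S₁ n P)) := by
    rintro f P hP ⟨r, R, hr, hR, hsep⟩
    exact tendsto_riemann_bumpSampled (S₁ n) hC N hdom' ha ha0 haL η hηapply hηoff D hD1 f P hP
      (hreal f P hP (isOffDiagonal_of_isTensorOf_separated hP hr hsep)) hr hR hsep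
  intro f F hF hF'
  have hlim := stub_truncatedTieLimit n hn (stub_sepDensity n) (S₁ n) a L D _ N k₁ ha ha0 haL htemp
    hsepconv F hF'
  refine hlim.congr fun k => ?_
  push_cast
  rw [Finset.mul_sum, Finset.mul_sum]
  refine Finset.sum_congr rfl fun x _ => ?_
  rw [hF]
  simp [ofRealTest_apply]

/-- **Stub A4 — transfer of tempered approximants between admissible spacing/box data** (registered
signature of the skeleton `Cruxes/TemperedCurvatureMoments/Lines/Sketch.lean`, verbatim).  For `n > 0`
and a Schwinger family `S₁`: tempered tied lattice approximants of `S₁ n` along ONE admissible pair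
`(a', L')` give them along EVERY admissible pair `(a, L)`: approximants ⇒ domination
`‖S₁ n F‖ ≤ ∫ ‖F‖ w` on `⁰𝒮` (`stub_dominatedTieLimit`) and realness of `S₁ n` on off-diagonal real
tensors (limits of real Riemann sums) ⇒ `temperedApproximants_of_dominated`. [folklore] -/
theorem stub_approximantsTransfer :
    ∀ (n : ℕ), 0 < n → ∀ (S₁ : SchwingerFamily E4) (a a' : ℕ → ℝ) (L L' : ℕ → ℕ),
      (∀ k, 0 < a k) → Tendsto a atTop (𝓝 0) → Tendsto (fun k => a k * L k) atTop atTop →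
      (∀ k, 0 < a' k) → Tendsto a' atTop (𝓝 0) → Tendsto (fun k => a' k * L' k) atTop atTop →
      TemperedApproximants a' L' S₁ n → TemperedApproximants a L S₁ n := by
  intro n hn S₁ a a' L L' ha ha0 haL ha' ha0' haL' hT'
  obtain ⟨D', C, N, k₀', hC, hD', htie'⟩ := hT'
  obtain ⟨hwm, hwc, hw0⟩ := weight_measurable_continuousOn_nonneg n hC N
  have hdom := stub_dominatedTieLimit n hn (S₁ n) a' L' D' _ C N k₀' ha' ha0' haL' hwm hwc hw0
    (fun y _ => le_rfl) hD' htie'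
  -- realness: a limit in `ℂ` of real Riemann sums lies in the closed set `{im = 0}`
  have hreal : ∀ (f : Fin n → 𝓢(E4, ℝ)) (F : 𝓢((Fin n → E4), ℂ)),
      IsTensorOf F (fun i => ofRealTest (f i)) → IsOffDiagonal F → (S₁ n F).im = 0 :=
    fun f F hF hF' => (isClosed_eq Complex.continuous_im continuous_const :
      IsClosed {z : ℂ | z.im = 0}).mem_of_tendsto (htie' f F hF hF')
        (Eventually.of_forall fun k => Complex.ofReal_im _)
  exact temperedApproximants_of_dominated hn S₁ hC hdom hreal ha ha0 haL

end Summit.QuantumFields.YangMills.Theorems.TemperedCurvatureMoments.Sketch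

end
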